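import Summits.BirchSwinnertonDyer.BirchSwinnertonDyer.Theorems.ThetaPartnerAtTwoSignedControlAtTwoSignedCasselsCount
import Summits.BirchSwinnertonDyer.BirchSwinnertonDyer.Theorems.ThetaPartnerAtTwoSignedControlAtTwoSignedCoinvChase
import Literature.NumberTheory.EllipticCurves.BDKim2013.SignedEulerCharAssemblyProofs
import Literature.NumberTheory.EllipticCurves.BDKim2013.SignedCharValueRankZero
import Summits.BirchSwinnertonDyer.BirchSwinnertonDyer.Theses.SignedLowerHalves
import Summits.BirchSwinnertonDyer.BirchSwinnertonDyer.Theses.SignedBaseChange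
import Summits.BirchSwinnertonDyer.BirchSwinnertonDyer.Theses.PrintX6
import HarnessLib

/-!
# B. D. Kim 2013 Cor. 3.15 (the signed `Γ`-Euler characteristic in rank `0`, `F = ℚ`, `p` odd) — the
# Literature fact `BDKim2013.cor315_signedCharValue_rankZero` = route decl `BDKimSignedCharValueRankZero`
# BY NAME — DERIVED from Cassels' theorem BY NAME (`Greenberg1999.casselsSurjectivity_H1Sigma ℚ`) and the two
# `±`-specific inputs of Kim's printed proof, DISPLAYED: «`g_v` injective for `v ∣ p`» and Thm. 3.14

LADDER-BSD D-0154 (2) INPUTS→UNCONDITIONAL, INPUTS-LIST-2 row F10, seat `bsd-inputs-kim315-p1`; item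
stmt-BirchSwinnertonDyer-19288 (`BDKimSignedCharValueRankZero` of routes `SignedLowerHalves` /
`SignedBaseChange`, `InputKimCor315` of `PrintX6`; all three are `BDKim2013.cor315_signedCharValue_rankZero`
by name), served `--supports`. HONEST FRAMING: THEOREMS ONLY (no definition, no named fact, no `sorry`); the
`Theses` files are imported only to conclude the three route decls BY NAME in §4 (conditional results, item not
closed); nothing about any curve is asserted beyond the displayed hypotheses; the two displayed `±` inputs and
Cassels' theorem are published results not proved in the tree; BSD is not proved by any of this.

## The printed proof (B. D. Kim, J. Aust. Math. Soc. 95 (2013), pp. 199–200) and where each step now lives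

"**Corollary 3.15.** Assume that `Sel_p(E/F)` is finite. Let `(f^±) ⊂ Λ` be the characteristic ideal of
`Sel^±_p(E/F_∞)^∨`. Then `|f^±(0)| ∼ |Sel_p(E/F)| ∏_v c_v`. *Proof.* … our assumption implies that
`Sel^±_p(E/F_∞)` is `Λ`-cotorsion [KERNEL: `BDKim2013.isTorsion_of_finite_selmerGroup_of_finite_kerG`] … the
diagram [control at `n = 0`; KERNEL: `BDKim2013/SignedEulerCharAssemblyProofs` §1, `SignedEC` §1] … the middle
vertical map is an isomorphism [KERNEL: `E(ℚ)[p] = 0` at a good supersingular `p ≥ 3`, Greenberg's Lemma 3.2] …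
If `v ∣ p`, `g_v` is injective because `E(F_v) ⊗ ℚ_p/ℤ_p = (∏_{w∣v} H^±_w)^Γ` (see the proof of [6, Prop. 4.28])
[DISPLAYED input (INJ^ε): hypothesis `hinj` below; Kobayashi 2003 (9.33)] … Since `Sel_p(E/F)` is finite, the map
`a` is surjective by Proposition 3.8 [Cassels–Poitou–Tate; PRINT BY NAME: `Greenberg1999.casselsSurjectivity_H1Sigma ℚ`
+ KERNEL `SignedEC.natCard_signedKerG_eq_pow_of_casselsSurjectivity`] … `|ker(g_v)| = 1 = c_v` (`v ∣ p`) …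
`|ker(g_v)| ∼ c_v` (`v ∤ p`, [2, Lemma 3.3]) [KERNEL: Greenberg p. 88 count along the cyclotomic tower,
`Rank1Residual.Additive.natCard_localTowerKerPrimary_zero_eq_pow_of_isCyclotomic`, inside the previous theorem] …
From [2, Lemma 4.2] we have `f^±(0) ∼ |Sel^±_p(E/F_∞)^Γ| / |Sel^±_p(E/F_∞)_Γ|` [KERNEL: Greenberg's Lemma 4.2 on
`SignedSelmerDualData.isDualPair`, `BDKim2013.constantCoeff_charGenerator_mul_natCard_signedEndCoinvariants_rat`]
`= |Sel^±_p(E/F_∞)^Γ|`. (The last equality is from Theorem 3.14.) [DISPLAYED input (Thm. 3.14), in its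
Pontryagin-dual reading «`X^±` has no nonzero finite `Λ`-submodule», turned into `#(Sel^±_∞)_Γ = 1` by the KERNEL
equivalence `SignedEC.natCard_signedEndCoinvariants_eq_one_iff_forall_finite_eq_bot`]."

## What is proved (namespace `…Theorems.KimCor315`)

* `no_pTorsion_of_supersingular` — `E(ℚ)[p] = 0` for `p ≠ 2` good with `p ∣ a_p` (anomalous-prime lemma, tree).
* `cor315_body_of_cassels_of_localInj_of_coinv` — for ONE curve/prime/tower/sign/datum: Cassels by name +
  INJ^ε (displayed) + «`(Sel^ε_∞)_γ` finite ⇒ `#(Sel^ε_∞)_γ = 1`» (displayed) + `Sel_{p^∞}(E/ℚ)` finite ⇒ `X^ε` is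
  `Λ`-torsion AND `f(0) = u · p^{ord_p ∏ c_v} · #Sel_{p^∞}(E/ℚ)` for every generator `f` of `char X^ε`.
* `cor315_body_of_cassels_of_localInj_of_noFiniteSubmodule` — the same with the coinvariant input in Kim's
  Thm. 1.1 / 3.14 shape «`X^ε` torsion ⇒ no nonzero finite `Λ`-submodule».
* **`cor315_of_casselsSurjectivity_of_localInj_of_thm314`** — the Literature fact
  `BDKim2013.cor315_signedCharValue_rankZero` ITSELF (hence the three route decls, which are this constant)
  from `Greenberg1999.casselsSurjectivity_H1Sigma ℚ` and the two `±` inputs quantified in the fact's own binder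
  shape (the bodies the sibling statement file `BDKim2013/…` types as named facts).

References: [BDKim2013] Cor. 3.15 and proof (pp. 199–200), Thm. 3.14 (p. 198), Thm. 1.1; [GreenbergLNM1716]
§3 Lemmas 3.2–3.3, p. 88, §4 Lemmas 4.2–4.7, Prop. 4.13 (p. 122); [Kobayashi2003] Def. 1.1, (9.33), Thm. 9.3;
[Cassels1964ArithmeticVII]. Credit: the K4 lane `SignedEC` (seat `prover-bsd-wall-tp2-p3`, p = 2) whose
parity-free theorems are consumed here at odd `p`.
-/

set_option autoImplicit false
-- the Theorems namespace of this sub repeats the summit name by design (D-0017 nested layout)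
set_option linter.dupNamespace false

noncomputable section

open scoped Classical NumberField

open NumberField IsDedekindDomain

universe u

namespace Summit.BirchSwinnertonDyer.BirchSwinnertonDyer.Theorems.KimCor315

open Literature.NumberTheory.EllipticCurves Literature.NumberTheory.GaloisRepresentations
  WeierstrassCurve ZpExtension Literature.NumberTheory.EllipticCurves.Kobayashi2003
  Literature.NumberTheory.EllipticCurves.IwasawaDual Literature.NumberTheory.EllipticCurves.IwasawaAlgebra
  Summit.BirchSwinnertonDyer.BirchSwinnertonDyer.Theorems.SignedEC

variable (W : WeierstrassCurve ℚ) [W.IsElliptic] [W.IsGloballyMinimal] (p : ℕ) [Fact p.Prime]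

/-! ## §1 `E(ℚ)[p] = 0` at a good supersingular `p ≥ 3` -/

/-- **`E(ℚ)[p] = 0` at a good prime `p ≠ 2` with `p ∣ a_p`** (in particular `a_p = 0`): a rational point of
order `p` at a good `p ≥ 3` forces `a_p ≡ 1 (mod p)` (tree `dvd_frobeniusTrace_sub_one_of_addOrderOf_eq`,
Silverman VII.3.1(b)), incompatible with `p ∣ a_p`. Kim's Prop. 3.2 («`E(F_{n,v})` is `p`-torsion-free») over
`ℚ`; Sprung 2024 p. 41 («we necessarily have `|E(ℚ)_p| = 1`»). The `DecidableEq ℚ` instance of the group law is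
the ambient one (bridged to the tree lemma's by `Rank1Residual.addOrderOf_point_eq_of_subsingleton`).
[cite: SilvermanAEC2009, VII.3.1(b)] [cite: BDKim2013, Prop. 3.2 (p. 193)] -/
theorem no_pTorsion_of_supersingular (hp2 : p ≠ 2) (hgood : W.HasGoodReductionAtPrime p)
    (hap : (p : ℤ) ∣ W.frobeniusTrace p) : ∀ P : W.toAffine.Point, p • P = 0 → P = 0 := by
  intro P hP
  by_contra hP0
  have hpP : p.Prime := Fact.out
  have hp3 : 3 ≤ p := by have := hpP.two_le; omega
  have hT : addOrderOf P = p := addOrderOf_eq_prime hP hP0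
  have h1 := dvd_frobeniusTrace_sub_one_of_addOrderOf_eq W p hp3 hgood
    ((Rank1Residual.addOrderOf_point_eq_of_subsingleton W _ _ P).trans hT)
  have hone : (p : ℤ) ∣ 1 := by simpa using dvd_sub hap h1
  have hp1 : (p : ℤ) ≤ 1 := Int.le_of_dvd one_pos hone
  have : (2 : ℤ) ≤ p := by exact_mod_cast hpP.two_le
  omega

/-! ## §2 Cor. 3.15 for one curve / prime / sign / datum from Cassels BY NAME + INJ^ε + COINV (displayed) -/

/-- **B. D. Kim's Cor. 3.15 for ONE `(W, p, κ, γ, ε, D)`, from Cassels' theorem BY NAME, the local injectivity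
at `p` and the vanishing of the coinvariants (both displayed).** `W/ℚ` elliptic, globally minimal; `p ≠ 2` of
good reduction with `a_p = 0`; `κ` the cyclotomic `ℤ_p`-extension with topological generator `γ`; `ε` a sign;
`D` a Pontryagin-dual datum of Kobayashi's `Sel^ε(E/ℚ_∞)`. ASSUME: (C) `Greenberg1999.casselsSurjectivity_H1Sigma ℚ`
(LNM 1716 Prop. 4.13 = Kim's «`a` is surjective by Proposition 3.8»); (INJ^ε) every class `y ∈ H¹(ℚ, E[p^∞])`
with `h_0 y ∈ Sel^ε(E/ℚ_∞)` satisfies the classical local condition at the place above `p` (Kim: «If `v ∣ p`,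
`g_v` is injective»; Kobayashi (9.33)); (COINV) `(Sel^ε_∞)_γ` finite ⇒ `#(Sel^ε_∞)_γ = 1` (Kim's Thm. 3.14
«`Sel^±_p(E/F_∞)_Γ = 0`»); and `Sel_{p^∞}(E/ℚ)` finite. THEN `X^ε = D.X` is `Λ`-torsion (the first sentence of the
printed proof, here a CONSEQUENCE: INJ ⇒ `ker g^ε` finite ⇒ `A^ε_0` finite ⇒ `(Sel^ε_∞)^γ` finite ⇒ torsion) and
for every generator `f` of `char X^ε`: **`f(0) = u · p^{ord_p(∏_v c_v)} · #Sel_{p^∞}(E/ℚ)`**, `u ∈ ℤ_pˣ`. Chain: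
`#(A^ε_0/Sel_0) = p^{ord_p ∏ c_v}` (`SignedEC.natCard_signedKerG_eq_pow_of_casselsSurjectivity`, with
`E(ℚ)[p] = 0` from §1 feeding `#E[p^∞]^{Γ_ℚ} = 1` and the injectivity of every `h_m`);
`f(0) · #(Sel^ε_∞)_γ = u · #Sel_{p^∞}(E/ℚ) · #(A^ε_0/Sel_0)` (`BDKim2013.constantCoeff_charGenerator_mul_natCard_signedEndCoinvariants_rat`);
`#(Sel^ε_∞)_γ = 1` (COINV). [cite: BDKim2013, Cor. 3.15 and its proof (pp. 199–200), Thm. 3.14 (p. 198)]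
[cite: GreenbergLNM1716, §4 Lemmas 4.2, 4.3, 4.7, Prop. 4.13 (pp. 102–108, 122)] [cite: Kobayashi2003, (9.33) and Thm. 9.3 (pp. 26–27)] -/
theorem cor315_body_of_cassels_of_localInj_of_coinv (hC : Greenberg1999.casselsSurjectivity_H1Sigma ℚ)
    (hp2 : p ≠ 2) (hgood : W.HasGoodReductionAtPrime p) (hap : W.frobeniusTrace p = 0)
    (κ : ZpExtension ℚ p) {γ : Field.absoluteGaloisGroup ℚ} (hκ : κ.IsCyclotomic) (hγ : κ.IsTopGenerator γ)
    (ε : ℤˣ) (D : SignedSelmerDualData W κ γ ε)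
    (hinj : ∀ v : HeightOneSpectrum (𝓞 ℚ), (p : 𝓞 ℚ) ∈ v.asIdeal →
      ∀ y ∈ (signedSelmerInfty W κ ε).comap (W.layerToInfty κ 0),
        W.localResOver p (κ.layerSubgroup 0) (v.adicCompletion ℚ) y = 0)
    (hcoinv : Finite (EndCoinvariants (conjSignedSelmerInfty W κ ε γ - 1)) →
      Nat.card (EndCoinvariants (conjSignedSelmerInfty W κ ε γ - 1)) = 1)
    (hSel : Finite (W.selmerGroupPInfty p)) (f : IwasawaAlgebra p) (hf : D.charIdeal = Ideal.span {f}) :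
    Module.IsTorsion (IwasawaAlgebra p) D.X ∧
      ∃ u : ℤ_[p]ˣ,
        ((PowerSeries.constantCoeff f : ℤ_[p]) : ℚ_[p]) =
          ((u : ℤ_[p]) : ℚ_[p]) * (p : ℚ_[p]) ^ (padicValNat p W.tamagawaProduct) *
            (Nat.card (W.selmerGroupPInfty p) : ℚ_[p]) := by
  have hpP : p.Prime := Fact.out
  have hap' : (p : ℤ) ∣ W.frobeniusTrace p := by rw [hap]; exact dvd_zero _
  -- `E(ℚ)[p] = 0`: `#E[p^∞]^{Γ_ℚ} = 1` and every `h_m` is injective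
  have hK := no_pTorsion_of_supersingular W p hp2 hgood hap'
  have hE : Nat.card (MulAction.fixedPoints (Field.absoluteGaloisGroup ℚ) (W.geomPrimaryTorsion p)) = 1 :=
    Sprung2024.natCard_fixedPoints_geomPrimaryTorsion_eq_one_of_supersingular W p hp2 hgood hap'
  have hinjh : ∀ m, Function.Injective (W.layerToInfty κ m) := fun m ↦ by
    refine Summit.BirchSwinnertonDyer.Rank1Residual.Additive.layerToInfty_injective_of_no_pTorsion W κ
      (fun P hP ↦ ?_) m
    apply hK P
    convert hP
  -- the place `v ∋ p`, good reduction there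
  obtain ⟨v, hv⟩ : ∃ v : HeightOneSpectrum (𝓞 ℚ), ((p : ℕ) : 𝓞 ℚ) ∈ v.asIdeal :=
    Literature.NumberTheory.EllipticCurves.exists_heightOneSpectrum_natCast_mem (K := ℚ) hpP
  have hgoodv : W.HasGoodReductionAt v := W.hasGoodReductionAt_of_hasGoodReductionAtPrime v hv hgood
  -- Cassels' count: `#(A^ε_0/Sel_0) = p^{ord_p ∏ c_v}`; in particular `A^ε_0/Sel_0` is finite
  have hcount := natCard_signedKerG_eq_pow_of_casselsSurjectivity W κ ε hC hκ hinjh hE hv hgoodv hinj hSel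
  have hkerg : Finite (↥((signedSelmerInfty W κ ε).comap (W.layerToInfty κ 0)) ⧸
      (W.selmerLayer κ 0).addSubgroupOf ((signedSelmerInfty W κ ε).comap (W.layerToInfty κ 0))) :=
    Nat.finite_of_card_ne_zero (by rw [hcount]; exact pow_ne_zero _ hpP.ne_zero)
  -- torsion (kernel) and the Euler-characteristic assembly over `ℚ`
  have htor : Module.IsTorsion (IwasawaAlgebra p) D.X :=
    BDKim2013.isTorsion_of_finite_selmerGroup_of_finite_kerG W κ ε hγ D hSel hkerg
  obtain ⟨-, hco, -, u, hu⟩ := BDKim2013.constantCoeff_charGenerator_mul_natCard_signedEndCoinvariants_rat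
    W p hp2 hgood hap κ hγ ε D htor f hf hSel hkerg
  refine ⟨htor, u, ?_⟩
  -- `#(Sel^ε_∞)_γ = 1` (COINV) and `#(A^ε_0/Sel_0) = p^{ord_p ∏ c_v}` (Cassels' count)
  rw [hcoinv hco, hcount, Nat.cast_one, mul_one] at hu
  have key : ((PowerSeries.constantCoeff f : ℤ_[p]) : ℚ_[p]) =
      (((u : ℤ_[p]) * Nat.card ↥(W.selmerGroupPInfty p) * (p ^ padicValNat p W.tamagawaProduct : ℕ) : ℤ_[p]) :
        ℚ_[p]) := by
    rw [hu]
  rw [key]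
  push_cast
  ring

/-- **The same with the coinvariant input in B. D. Kim's Thm. 1.1 / Thm. 3.14 shape** («if `Sel^±_p(E/F_∞)` is
`Λ`-cotorsion then it has no proper `Λ`-submodule of finite index», read on the Pontryagin dual: `X^ε` torsion ⇒
every finite `Λ`-submodule of `X^ε = D.X` is `0`), turned into COINV by the kernel equivalence
`SignedEC.natCard_signedEndCoinvariants_eq_one_iff_forall_finite_eq_bot` (Pontryagin duality `X[T] ≅ (S_γ)^∨`);
the torsion premise is discharged in the kernel as in the previous theorem.
[cite: BDKim2013, Thm. 1.1 (p. 190), Thm. 3.14 (p. 198), Cor. 3.15 (pp. 199–200)] [cite: GreenbergLNM1716, §4 p. 104] -/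
theorem cor315_body_of_cassels_of_localInj_of_noFiniteSubmodule
    (hC : Greenberg1999.casselsSurjectivity_H1Sigma ℚ)
    (hp2 : p ≠ 2) (hgood : W.HasGoodReductionAtPrime p) (hap : W.frobeniusTrace p = 0)
    (κ : ZpExtension ℚ p) {γ : Field.absoluteGaloisGroup ℚ} (hκ : κ.IsCyclotomic) (hγ : κ.IsTopGenerator γ)
    (ε : ℤˣ) (D : SignedSelmerDualData W κ γ ε)
    (hinj : ∀ v : HeightOneSpectrum (𝓞 ℚ), (p : 𝓞 ℚ) ∈ v.asIdeal →
      ∀ y ∈ (signedSelmerInfty W κ ε).comap (W.layerToInfty κ 0),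
        W.localResOver p (κ.layerSubgroup 0) (v.adicCompletion ℚ) y = 0)
    (hkim : Module.IsTorsion (IwasawaAlgebra p) D.X →
      ∀ N : Submodule (IwasawaAlgebra p) D.X, Finite N → N = ⊥)
    (hSel : Finite (W.selmerGroupPInfty p)) (f : IwasawaAlgebra p) (hf : D.charIdeal = Ideal.span {f}) :
    Module.IsTorsion (IwasawaAlgebra p) D.X ∧
      ∃ u : ℤ_[p]ˣ,
        ((PowerSeries.constantCoeff f : ℤ_[p]) : ℚ_[p]) =
          ((u : ℤ_[p]) : ℚ_[p]) * (p : ℚ_[p]) ^ (padicValNat p W.tamagawaProduct) *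
            (Nat.card (W.selmerGroupPInfty p) : ℚ_[p]) := by
  have hpP : p.Prime := Fact.out
  have hap' : (p : ℤ) ∣ W.frobeniusTrace p := by rw [hap]; exact dvd_zero _
  -- torsion first (kernel), to feed Kim's Thm. 3.14 shape
  have hK := no_pTorsion_of_supersingular W p hp2 hgood hap'
  have hE : Nat.card (MulAction.fixedPoints (Field.absoluteGaloisGroup ℚ) (W.geomPrimaryTorsion p)) = 1 :=
    Sprung2024.natCard_fixedPoints_geomPrimaryTorsion_eq_one_of_supersingular W p hp2 hgood hap'
  have hinjh : ∀ m, Function.Injective (W.layerToInfty κ m) := fun m ↦ by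
    refine Summit.BirchSwinnertonDyer.Rank1Residual.Additive.layerToInfty_injective_of_no_pTorsion W κ
      (fun P hP ↦ ?_) m
    apply hK P
    convert hP
  obtain ⟨v, hv⟩ : ∃ v : HeightOneSpectrum (𝓞 ℚ), ((p : ℕ) : 𝓞 ℚ) ∈ v.asIdeal :=
    Literature.NumberTheory.EllipticCurves.exists_heightOneSpectrum_natCast_mem (K := ℚ) hpP
  have hgoodv : W.HasGoodReductionAt v := W.hasGoodReductionAt_of_hasGoodReductionAtPrime v hv hgood
  have hcount := natCard_signedKerG_eq_pow_of_casselsSurjectivity W κ ε hC hκ hinjh hE hv hgoodv hinj hSel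
  have hkerg : Finite (↥((signedSelmerInfty W κ ε).comap (W.layerToInfty κ 0)) ⧸
      (W.selmerLayer κ 0).addSubgroupOf ((signedSelmerInfty W κ ε).comap (W.layerToInfty κ 0))) :=
    Nat.finite_of_card_ne_zero (by rw [hcount]; exact pow_ne_zero _ hpP.ne_zero)
  have htor : Module.IsTorsion (IwasawaAlgebra p) D.X :=
    BDKim2013.isTorsion_of_finite_selmerGroup_of_finite_kerG W κ ε hγ D hSel hkerg
  exact cor315_body_of_cassels_of_localInj_of_coinv W p hC hp2 hgood hap κ hκ hγ ε D hinj
    (fun hfin ↦ (natCard_signedEndCoinvariants_eq_one_iff_forall_finite_eq_bot D hγ hfin).mpr (hkim htor))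
    hSel f hf

end Summit.BirchSwinnertonDyer.BirchSwinnertonDyer.Theorems.KimCor315

/-! ## §3 The Literature fact `cor315_signedCharValue_rankZero` from Cassels BY NAME + the two `±` inputs -/

namespace Summit.BirchSwinnertonDyer.BirchSwinnertonDyer.Theorems.KimCor315

open Literature.NumberTheory.EllipticCurves Literature.NumberTheory.GaloisRepresentations
  WeierstrassCurve ZpExtension Literature.NumberTheory.EllipticCurves.Kobayashi2003
  Literature.NumberTheory.EllipticCurves.IwasawaDual Literature.NumberTheory.EllipticCurves.IwasawaAlgebra

/-- **B. D. Kim 2013 Cor. 3.15 — the Literature fact `BDKim2013.cor315_signedCharValue_rankZero` itself (hence the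
route decls `SignedLowerHalves.BDKimSignedCharValueRankZero`, `SignedBaseChange.BDKimSignedCharValueRankZero`,
`PrintX6.InputKimCor315`, which ARE this constant) — from Cassels' theorem BY NAME and the two `±`-specific
inputs of the printed proof, each quantified in the fact's own binder shape:** (INJ) for every `W/ℚ` elliptic,
globally minimal, `p ≠ 2` good with `a_p = 0`, cyclotomic `κ`, sign `ε`, the place `v ∋ p`: every
`y ∈ h_0⁻¹(Sel^ε(E/ℚ_∞))` satisfies the classical local condition at `v` (Kim p. 199 «`g_v` is injective», Kobayashi
(9.33)); (KIM) for every such datum with topological generator `γ` and Pontryagin-dual datum `D`: `X^ε` torsion ⇒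
`X^ε` has no nonzero finite `Λ`-submodule (Thm. 1.1 / Thm. 3.14 read on the dual). So the by-name input F10 of the
rows 6–8 packs (`PublishedSignedInputs`, `PublishedInputsX6`) is CONDITIONAL exactly on {Cassels (LNM 1716
Prop. 4.13), INJ^±, Kim Thm. 3.14}; its control-theorem / Euler-characteristic / Tamagawa content is kernel-checked.
[cite: BDKim2013, Cor. 3.15 (p. 199) and proof (pp. 199–200), Thm. 3.14, Thm. 1.1]
[cite: GreenbergLNM1716, §4 Prop. 4.13 (p. 122), Lemmas 4.2–4.7] [cite: Kobayashi2003, (9.33), Thm. 9.3] -/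
theorem cor315_of_casselsSurjectivity_of_localInj_of_thm314
    (hC : Greenberg1999.casselsSurjectivity_H1Sigma ℚ)
    (hINJ : ∀ (W : WeierstrassCurve ℚ) [W.IsElliptic] [W.IsGloballyMinimal] (p : ℕ) [Fact p.Prime],
      p ≠ 2 → W.HasGoodReductionAtPrime p → W.frobeniusTrace p = 0 →
      ∀ (κ : ZpExtension ℚ p), κ.IsCyclotomic → ∀ (ε : ℤˣ) (v : HeightOneSpectrum (𝓞 ℚ)),
        (p : 𝓞 ℚ) ∈ v.asIdeal → ∀ y ∈ (signedSelmerInfty W κ ε).comap (W.layerToInfty κ 0),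
          W.localResOver p (κ.layerSubgroup 0) (v.adicCompletion ℚ) y = 0)
    (hKIM : ∀ (W : WeierstrassCurve ℚ) [W.IsElliptic] [W.IsGloballyMinimal] (p : ℕ) [Fact p.Prime],
      p ≠ 2 → W.HasGoodReductionAtPrime p → W.frobeniusTrace p = 0 →
      ∀ (κ : ZpExtension ℚ p) (γ : Field.absoluteGaloisGroup ℚ), κ.IsCyclotomic → κ.IsTopGenerator γ →
      ∀ (ε : ℤˣ) (D : SignedSelmerDualData W κ γ ε) [Module.Finite (IwasawaAlgebra p) D.X],
        Module.IsTorsion (IwasawaAlgebra p) D.X →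
        ∀ N : Submodule (IwasawaAlgebra p) D.X, Finite N → N = ⊥) :
    BDKim2013.cor315_signedCharValue_rankZero := by
  intro W _ _ p _ hp2 hgood hap κ γ hκ hγ ε D _ _ f hf hSel
  exact (cor315_body_of_cassels_of_localInj_of_noFiniteSubmodule W p hC hp2 hgood hap κ hκ hγ ε D
    (fun v hv y hy ↦ hINJ W p hp2 hgood hap κ hκ ε v hv y hy)
    (fun hX ↦ hKIM W p hp2 hgood hap κ γ hκ hγ ε D hX) hSel f hf).2

/-- **Bookkeeping corollary: the COTORSION hypothesis of the fact is idle.** Under Cassels BY NAME and INJ^ε,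
`Sel_{p^∞}(E/ℚ)` finite already forces `X^ε(E/ℚ_∞)` to be `Λ`-torsion for every Pontryagin-dual datum (INJ ⇒
`ker g^ε` finite ⇒ `A^ε_0` finite ⇒ `(Sel^ε_∞)^γ` finite ⇒ torsion, Greenberg's Thm. 1.4 argument) — the first
sentence of Kim's proof («our assumption implies that `Sel^±_p(E/F_∞)` is `Λ`-cotorsion because the control
theorem holds true for the plus/minus Selmer groups»), whose control-theorem input is here INJ^ε alone.
[cite: BDKim2013, proof of Cor. 3.15 (p. 199)] [cite: Kobayashi2003, Thm. 9.3] [cite: GreenbergLNM1716, §1 Thm. 1.4] -/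
theorem isTorsion_of_casselsSurjectivity_of_localInj (hC : Greenberg1999.casselsSurjectivity_H1Sigma ℚ)
    (W : WeierstrassCurve ℚ) [W.IsElliptic] [W.IsGloballyMinimal] (p : ℕ) [Fact p.Prime]
    (hp2 : p ≠ 2) (hgood : W.HasGoodReductionAtPrime p) (hap : W.frobeniusTrace p = 0)
    (κ : ZpExtension ℚ p) {γ : Field.absoluteGaloisGroup ℚ} (hκ : κ.IsCyclotomic) (hγ : κ.IsTopGenerator γ)
    (ε : ℤˣ) (D : SignedSelmerDualData W κ γ ε)
    (hinj : ∀ v : HeightOneSpectrum (𝓞 ℚ), (p : 𝓞 ℚ) ∈ v.asIdeal →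
      ∀ y ∈ (signedSelmerInfty W κ ε).comap (W.layerToInfty κ 0),
        W.localResOver p (κ.layerSubgroup 0) (v.adicCompletion ℚ) y = 0)
    (hSel : Finite (W.selmerGroupPInfty p)) :
    Module.IsTorsion (IwasawaAlgebra p) D.X := by
  have hpP : p.Prime := Fact.out
  have hap' : (p : ℤ) ∣ W.frobeniusTrace p := by rw [hap]; exact dvd_zero _
  have hK := no_pTorsion_of_supersingular W p hp2 hgood hap'
  have hE : Nat.card (MulAction.fixedPoints (Field.absoluteGaloisGroup ℚ) (W.geomPrimaryTorsion p)) = 1 :=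
    Sprung2024.natCard_fixedPoints_geomPrimaryTorsion_eq_one_of_supersingular W p hp2 hgood hap'
  have hinjh : ∀ m, Function.Injective (W.layerToInfty κ m) := fun m ↦ by
    refine Summit.BirchSwinnertonDyer.Rank1Residual.Additive.layerToInfty_injective_of_no_pTorsion W κ
      (fun P hP ↦ ?_) m
    apply hK P
    convert hP
  obtain ⟨v, hv⟩ : ∃ v : HeightOneSpectrum (𝓞 ℚ), ((p : ℕ) : 𝓞 ℚ) ∈ v.asIdeal :=
    Literature.NumberTheory.EllipticCurves.exists_heightOneSpectrum_natCast_mem (K := ℚ) hpP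
  have hgoodv : W.HasGoodReductionAt v := W.hasGoodReductionAt_of_hasGoodReductionAtPrime v hv hgood
  have hcount := SignedEC.natCard_signedKerG_eq_pow_of_casselsSurjectivity W κ ε hC hκ hinjh hE hv hgoodv
    hinj hSel
  have hkerg : Finite (↥((signedSelmerInfty W κ ε).comap (W.layerToInfty κ 0)) ⧸
      (W.selmerLayer κ 0).addSubgroupOf ((signedSelmerInfty W κ ε).comap (W.layerToInfty κ 0))) :=
    Nat.finite_of_card_ne_zero (by rw [hcount]; exact pow_ne_zero _ hpP.ne_zero)
  exact BDKim2013.isTorsion_of_finite_selmerGroup_of_finite_kerG W κ ε hγ D hSel hkerg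

/-! ## §4 The three route decls BY NAME (conditional on Cassels + INJ^ε + Kim Thm. 3.14) -/

/-- **Route `SignedLowerHalves`, support `BDKimSignedCharValueRankZero` (stmt-BirchSwinnertonDyer-19288) from
Cassels' theorem BY NAME + INJ^ε + Kim's Thm. 3.14** (the route decl is the constant
`BDKim2013.cor315_signedCharValue_rankZero`). CONDITIONAL result: the item is not closed.
[cite: BDKim2013, Cor. 3.15 (p. 199)] [cite: GreenbergLNM1716, §4 Prop. 4.13 (p. 122)] -/
theorem signedLowerHalves_bdKimSignedCharValueRankZero_of_casselsSurjectivity_of_localInj_of_thm314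
    (hC : Greenberg1999.casselsSurjectivity_H1Sigma ℚ)
    (hINJ : ∀ (W : WeierstrassCurve ℚ) [W.IsElliptic] [W.IsGloballyMinimal] (p : ℕ) [Fact p.Prime],
      p ≠ 2 → W.HasGoodReductionAtPrime p → W.frobeniusTrace p = 0 →
      ∀ (κ : ZpExtension ℚ p), κ.IsCyclotomic → ∀ (ε : ℤˣ) (v : HeightOneSpectrum (𝓞 ℚ)),
        (p : 𝓞 ℚ) ∈ v.asIdeal → ∀ y ∈ (signedSelmerInfty W κ ε).comap (W.layerToInfty κ 0),
          W.localResOver p (κ.layerSubgroup 0) (v.adicCompletion ℚ) y = 0)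
    (hKIM : ∀ (W : WeierstrassCurve ℚ) [W.IsElliptic] [W.IsGloballyMinimal] (p : ℕ) [Fact p.Prime],
      p ≠ 2 → W.HasGoodReductionAtPrime p → W.frobeniusTrace p = 0 →
      ∀ (κ : ZpExtension ℚ p) (γ : Field.absoluteGaloisGroup ℚ), κ.IsCyclotomic → κ.IsTopGenerator γ →
      ∀ (ε : ℤˣ) (D : SignedSelmerDualData W κ γ ε) [Module.Finite (IwasawaAlgebra p) D.X],
        Module.IsTorsion (IwasawaAlgebra p) D.X →
        ∀ N : Submodule (IwasawaAlgebra p) D.X, Finite N → N = ⊥) :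
    Summit.BirchSwinnertonDyer.BirchSwinnertonDyer.Theses.SignedLowerHalves.BDKimSignedCharValueRankZero :=
  cor315_of_casselsSurjectivity_of_localInj_of_thm314 hC hINJ hKIM

/-- **Route `SignedBaseChange`, support `BDKimSignedCharValueRankZero` (same item 19288, same constant) from
Cassels BY NAME + INJ^ε + Kim's Thm. 3.14.** CONDITIONAL result: the item is not closed.
[cite: BDKim2013, Cor. 3.15 (p. 199)] [cite: GreenbergLNM1716, §4 Prop. 4.13 (p. 122)] -/
theorem signedBaseChange_bdKimSignedCharValueRankZero_of_casselsSurjectivity_of_localInj_of_thm314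
    (hC : Greenberg1999.casselsSurjectivity_H1Sigma ℚ)
    (hINJ : ∀ (W : WeierstrassCurve ℚ) [W.IsElliptic] [W.IsGloballyMinimal] (p : ℕ) [Fact p.Prime],
      p ≠ 2 → W.HasGoodReductionAtPrime p → W.frobeniusTrace p = 0 →
      ∀ (κ : ZpExtension ℚ p), κ.IsCyclotomic → ∀ (ε : ℤˣ) (v : HeightOneSpectrum (𝓞 ℚ)),
        (p : 𝓞 ℚ) ∈ v.asIdeal → ∀ y ∈ (signedSelmerInfty W κ ε).comap (W.layerToInfty κ 0),
          W.localResOver p (κ.layerSubgroup 0) (v.adicCompletion ℚ) y = 0)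
    (hKIM : ∀ (W : WeierstrassCurve ℚ) [W.IsElliptic] [W.IsGloballyMinimal] (p : ℕ) [Fact p.Prime],
      p ≠ 2 → W.HasGoodReductionAtPrime p → W.frobeniusTrace p = 0 →
      ∀ (κ : ZpExtension ℚ p) (γ : Field.absoluteGaloisGroup ℚ), κ.IsCyclotomic → κ.IsTopGenerator γ →
      ∀ (ε : ℤˣ) (D : SignedSelmerDualData W κ γ ε) [Module.Finite (IwasawaAlgebra p) D.X],
        Module.IsTorsion (IwasawaAlgebra p) D.X →
        ∀ N : Submodule (IwasawaAlgebra p) D.X, Finite N → N = ⊥) :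
    Summit.BirchSwinnertonDyer.BirchSwinnertonDyer.Theses.SignedBaseChange.BDKimSignedCharValueRankZero :=
  cor315_of_casselsSurjectivity_of_localInj_of_thm314 hC hINJ hKIM

/-- **Route `PrintX6`, support `InputKimCor315` (same item 19288, same constant) from Cassels BY NAME + INJ^ε
+ Kim's Thm. 3.14.** CONDITIONAL result: the item is not closed.
[cite: BDKim2013, Cor. 3.15 (p. 199)] [cite: GreenbergLNM1716, §4 Prop. 4.13 (p. 122)] -/
theorem printX6_inputKimCor315_of_casselsSurjectivity_of_localInj_of_thm314
    (hC : Greenberg1999.casselsSurjectivity_H1Sigma ℚ)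
    (hINJ : ∀ (W : WeierstrassCurve ℚ) [W.IsElliptic] [W.IsGloballyMinimal] (p : ℕ) [Fact p.Prime],
      p ≠ 2 → W.HasGoodReductionAtPrime p → W.frobeniusTrace p = 0 →
      ∀ (κ : ZpExtension ℚ p), κ.IsCyclotomic → ∀ (ε : ℤˣ) (v : HeightOneSpectrum (𝓞 ℚ)),
        (p : 𝓞 ℚ) ∈ v.asIdeal → ∀ y ∈ (signedSelmerInfty W κ ε).comap (W.layerToInfty κ 0),
          W.localResOver p (κ.layerSubgroup 0) (v.adicCompletion ℚ) y = 0)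
    (hKIM : ∀ (W : WeierstrassCurve ℚ) [W.IsElliptic] [W.IsGloballyMinimal] (p : ℕ) [Fact p.Prime],
      p ≠ 2 → W.HasGoodReductionAtPrime p → W.frobeniusTrace p = 0 →
      ∀ (κ : ZpExtension ℚ p) (γ : Field.absoluteGaloisGroup ℚ), κ.IsCyclotomic → κ.IsTopGenerator γ →
      ∀ (ε : ℤˣ) (D : SignedSelmerDualData W κ γ ε) [Module.Finite (IwasawaAlgebra p) D.X],
        Module.IsTorsion (IwasawaAlgebra p) D.X →
        ∀ N : Submodule (IwasawaAlgebra p) D.X, Finite N → N = ⊥) :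
    Summit.BirchSwinnertonDyer.BirchSwinnertonDyer.Theses.PrintX6.InputKimCor315 :=
  cor315_of_casselsSurjectivity_of_localInj_of_thm314 hC hINJ hKIM

end Summit.BirchSwinnertonDyer.BirchSwinnertonDyer.Theorems.KimCor315

end
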